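import Literature.Probability.LatticeModels.IsingFieldVolume
import Literature.Probability.LatticeModels.IsingFieldGKS
import Literature.Probability.LatticeModels.IsingFieldTransport
import HarnessLib

/-!
# Absence of phase coexistence at the sites carrying a positive periodic field: `+` and `-`
# boundary conditions give the same magnetisation there (GHS concavity and convexity of the
# free energy)

Topic `Probability/LatticeModels`; continues `IsingFieldModel`/`Volume`/`GKS`/`Transport`. For the
finite-volume Ising model on a locally finite graph `G` with the site-dependent field `s·v`
(`v ≥ 0`), consider the `+` and `-` boundary-condition one-point functions
`⟨σ_k⟩^{±}_{Λ;β,sv}` (`plusMag`, `minusMag`) and their monotone limits over the volume,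
`m⁺_k(s) = inf_Λ ⟨σ_k⟩⁺_Λ(s)` and `m⁻_k(s) = sup_Λ ⟨σ_k⟩⁻_Λ(s)` (`infPlusMag`, `supMinusMag`;
FKG monotonicity in the volume, Friedli–Velenik 2017, Lemma 3.22). The main theorem
`exists_volume_plusMag_sub_minusMag_le` says: if `G` and `v` are invariant under a family of graph
automorphisms `φᵢ` which tile a sequence of volumes `Λₙ` by copies of a finite cell, with
`|∂ᵉΛₙ| / #copies → 0` (a van Hove sequence of complete cells), then at every site `c` of the cell
with `v_c > 0` and every `s₀ > 0`, `m⁺_c(s₀) = m⁻_c(s₀)`; in finite-volume form, for every `ε > 0`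
there is a finite `Λ₀` with `⟨σ_c⟩⁺_{Λ;β,s₀v} - ⟨σ_c⟩⁻_{Λ;β,s₀v} ≤ ε` for all `Λ ⊇ Λ₀`.

This is the "uniqueness of the Gibbs measure in a positive field" restricted to the sites that
carry the field, proved without complex analysis along the lines of Friedli–Velenik 2017,
Remark 3.41 ("The GHS inequality … allows an alternative proof of the differentiability of the
pressure when `h ≠ 0` … `h ↦ ⟨σ₀⟩⁺_{β,h}` is concave, and hence continuous") and Theorem 3.34
(`∂ψ/∂h± = m^±`, "the pressure is differentiable … if and only if there is a unique Gibbs state"),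
here for a periodic, site-dependent field and kept entirely in finite volume:

* convexity of `s ↦ log Z^{±}_{Λₙ}(s)` with derivative `β ∑_{k∈Λₙ} v_k ⟨σ_k⟩^{±}_{Λₙ}(s)`
  (`IsingFieldGKS`) and the surface bound `|log Z⁺_{Λₙ} - log Z⁻_{Λₙ}| ≤ 2β|∂ᵉΛₙ|`
  (`IsingFieldVolume`) give, for `s < s'`,
  `∑_{k∈Λₙ} v_k (⟨σ_k⟩⁺_{Λₙ}(s) - ⟨σ_k⟩⁻_{Λₙ}(s')) ≤ 4|∂ᵉΛₙ|/(s'-s)` (`sumPlusMag_sub_sumMinusMag_le`);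
* `⟨σ_k⟩⁺_{Λₙ} ≥ m⁺_k`, `⟨σ_k⟩⁻_{Λₙ} ≤ m⁻_k`, periodicity of `m^±` (transport) and the van Hove
  property give `M⁺(s) ≤ M⁻(s')` for the cell sums `M^± = ∑_{c ∈ cell} v_c m^±_c`
  (`cellSum_infPlusMag_le_cellSum_supMinusMag`) — the finite-volume shadow of
  `∂ψ/∂s⁺(s) ≤ ∂ψ/∂s⁻(s')`;
* GHS concavity of `s ↦ ⟨σ_c⟩⁺_Λ(s)` on `[0,∞)` (`IsingFieldGKS`) gives the chord bound
  `m⁺_c(s) ≥ -(s₀-s)/s₀ + (s/s₀) m⁺_c(s₀)`, so letting `s ↑ s₀`, `M⁻(s₀) ≥ M⁺(s₀)`; with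
  `m⁻ ≤ m⁺` termwise, `m⁺_c(s₀) = m⁻_c(s₀)` whenever `v_c > 0`.

## References

* S. Friedli, Y. Velenik, *Statistical Mechanics of Lattice Systems* (CUP 2017), Lemma 3.22,
  Prop. 3.29, Lemma 3.31, Theorem 3.34, Remark 3.41.
* C. J. Preston, *An application of the GHS inequalities to show the absence of phase transition
  for Ising spin systems*, Comm. Math. Phys. 35 (1974) 253–255.
* J. L. Lebowitz, A. Martin-Löf, *On the uniqueness of the equilibrium state for Ising spin
  systems*, Comm. Math. Phys. 25 (1972) 276–282.
-/

noncomputable section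

open MeasureTheory Finset Set Filter Topology

namespace Literature.Probability.LatticeModels

variable {V : Type*} (G : SimpleGraph V) [DecidableEq V] [G.LocallyFinite] (β : ℝ) (v : V → ℝ)

/-! ### The `±` boundary-condition magnetisations in the field `s·v` and their volume limits -/

/-- `⟨σ_k⟩⁺_{Λ;β,sv}`: the `+` boundary-condition one-point function in the field `s·v`.
[cite: FriedliVelenik2017, Lemma 3.31 (1)] -/
def plusMag (Λ : Finset V) (k : V) (s : ℝ) : ℝ :=
  fieldExpect G Λ β (affCpl 0 v s) .plus (spinAt k)

/-- `⟨σ_k⟩⁻_{Λ;β,sv}`: the `-` boundary-condition one-point function in the field `s·v`.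
[cite: FriedliVelenik2017, Lemma 3.31 (1)] -/
def minusMag (Λ : Finset V) (k : V) (s : ℝ) : ℝ :=
  fieldExpect G Λ β (affCpl 0 v s) .minus (spinAt k)

/-- `m⁺_k(s) = inf_Λ ⟨σ_k⟩⁺_{Λ;β,sv}` (the infinite-volume `+` magnetisation as an infimum over
finite volumes: the finite-volume `+` expectations decrease with the volume, Friedli–Velenik 2017,
Lemma 3.22 and Prop. 3.29). [cite: FriedliVelenik2017, Prop. 3.29] -/
def infPlusMag (k : V) (s : ℝ) : ℝ :=
  ⨅ Λ : Finset V, plusMag G β v Λ k s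

/-- `m⁻_k(s) = sup_Λ ⟨σ_k⟩⁻_{Λ;β,sv}`. [cite: FriedliVelenik2017, Prop. 3.29] -/
def supMinusMag (k : V) (s : ℝ) : ℝ :=
  ⨆ Λ : Finset V, minusMag G β v Λ k s

variable {G β v}

/-- `|⟨σ_k⟩⁺_Λ| ≤ 1`. [cite: FriedliVelenik2017, §3.6.1] -/
theorem abs_plusMag_le_one (Λ : Finset V) (k : V) (s : ℝ) : |plusMag G β v Λ k s| ≤ 1 :=
  abs_fieldExpect_le G Λ β _ _ fun σ => by
    rcases spinAt_eq_one_or_eq_neg_one k σ with h | h <;> simp [h]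

/-- `|⟨σ_k⟩⁻_Λ| ≤ 1`. [cite: FriedliVelenik2017, §3.6.1] -/
theorem abs_minusMag_le_one (Λ : Finset V) (k : V) (s : ℝ) : |minusMag G β v Λ k s| ≤ 1 :=
  abs_fieldExpect_le G Λ β _ _ fun σ => by
    rcases spinAt_eq_one_or_eq_neg_one k σ with h | h <;> simp [h]

/-- `⟨σ_k⟩⁺_Λ` decreases with `Λ` (FKG, Friedli–Velenik 2017, Lemma 3.22), `β ≥ 0`.
[cite: FriedliVelenik2017, Lemma 3.22] -/
theorem plusMag_anti (hβ : 0 ≤ β) {Λ₁ Λ₂ : Finset V} (h : Λ₁ ⊆ Λ₂) (k : V) (s : ℝ) :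
    plusMag G β v Λ₂ k s ≤ plusMag G β v Λ₁ k s :=
  fieldExpect_fixed_anti_volume G hβ h (fun _ _ => rfl) _ (spinAt_mono k) (measurable_spinAt k)

/-- `⟨σ_k⟩⁻_Λ` increases with `Λ` (FKG, Friedli–Velenik 2017, Lemma 3.22), `β ≥ 0`.
[cite: FriedliVelenik2017, Lemma 3.22] -/
theorem minusMag_mono (hβ : 0 ≤ β) {Λ₁ Λ₂ : Finset V} (h : Λ₁ ⊆ Λ₂) (k : V) (s : ℝ) :
    minusMag G β v Λ₁ k s ≤ minusMag G β v Λ₂ k s :=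
  fieldExpect_fixed_mono_volume G hβ h (fun _ _ => rfl) _ (spinAt_mono k) (measurable_spinAt k)

/-- `⟨σ_k⟩⁻_{Λ₁} ≤ ⟨σ_k⟩⁺_{Λ₂}` for all finite volumes (pass to `Λ₁ ∪ Λ₂` and compare the boundary
conditions, Friedli–Velenik 2017, Lemma 3.23 and eq. (3.25)). [cite: FriedliVelenik2017, Lemma 3.23] -/
theorem minusMag_le_plusMag (hβ : 0 ≤ β) (Λ₁ Λ₂ : Finset V) (k : V) (s : ℝ) :
    minusMag G β v Λ₁ k s ≤ plusMag G β v Λ₂ k s :=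
  calc minusMag G β v Λ₁ k s ≤ minusMag G β v (Λ₁ ∪ Λ₂) k s :=
        minusMag_mono hβ Finset.subset_union_left k s
    _ ≤ plusMag G β v (Λ₁ ∪ Λ₂) k s :=
        fieldExpect_fixed_mono G hβ _ _ (fun _ => neg_one_le_intUnits _) (spinAt_mono k)
          (measurable_spinAt k)
    _ ≤ plusMag G β v Λ₂ k s := plusMag_anti hβ Finset.subset_union_right k s

/-- The infimum defining `m⁺_k` is over a set bounded below (by `-1`). [folklore] -/
theorem bddBelow_range_plusMag (k : V) (s : ℝ) :
    BddBelow (Set.range fun Λ : Finset V => plusMag G β v Λ k s) :=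
  ⟨-1, by rintro _ ⟨Λ, rfl⟩; exact (abs_le.1 (abs_plusMag_le_one Λ k s)).1⟩

/-- The supremum defining `m⁻_k` is over a set bounded above (by `1`). [folklore] -/
theorem bddAbove_range_minusMag (k : V) (s : ℝ) :
    BddAbove (Set.range fun Λ : Finset V => minusMag G β v Λ k s) :=
  ⟨1, by rintro _ ⟨Λ, rfl⟩; exact (abs_le.1 (abs_minusMag_le_one Λ k s)).2⟩

/-- `m⁺_k(s) ≤ ⟨σ_k⟩⁺_Λ(s)` for every finite `Λ`. [cite: FriedliVelenik2017, Prop. 3.29] -/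
theorem infPlusMag_le_plusMag (Λ : Finset V) (k : V) (s : ℝ) :
    infPlusMag G β v k s ≤ plusMag G β v Λ k s :=
  ciInf_le (bddBelow_range_plusMag k s) Λ

/-- `⟨σ_k⟩⁻_Λ(s) ≤ m⁻_k(s)` for every finite `Λ`. [cite: FriedliVelenik2017, Prop. 3.29] -/
theorem minusMag_le_supMinusMag (Λ : Finset V) (k : V) (s : ℝ) :
    minusMag G β v Λ k s ≤ supMinusMag G β v k s :=
  le_ciSup (bddAbove_range_minusMag k s) Λ

/-- `-1 ≤ m⁺_k(s)`. [folklore] -/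
theorem neg_one_le_infPlusMag (k : V) (s : ℝ) : -1 ≤ infPlusMag G β v k s :=
  le_ciInf fun Λ => (abs_le.1 (abs_plusMag_le_one Λ k s)).1

/-- `m⁻_k ≤ m⁺_k` (`β ≥ 0`). [cite: FriedliVelenik2017, Lemma 3.23] -/
theorem supMinusMag_le_infPlusMag (hβ : 0 ≤ β) (k : V) (s : ℝ) :
    supMinusMag G β v k s ≤ infPlusMag G β v k s :=
  ciSup_le fun Λ₁ => le_ciInf fun Λ₂ => minusMag_le_plusMag hβ Λ₁ Λ₂ k s

/-! ### Invariance under field-preserving graph automorphisms (periodicity) -/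

/-- `⟨σ_{φk}⟩⁺_{φ(Λ)} = ⟨σ_k⟩⁺_Λ` for a graph automorphism `φ` preserving `v`.
[cite: FriedliVelenik2017, Prop. 3.29 (proof)] -/
theorem plusMag_map_equiv (φ : V ≃ V) (hadj : ∀ x y, (G.Adj (φ x) (φ y) ↔ G.Adj x y))
    (hφv : ∀ x, v (φ x) = v x) (Λ : Finset V) (k : V) (s : ℝ) :
    plusMag G β v (Λ.map φ.toEmbedding) (φ k) s = plusMag G β v Λ k s :=
  fieldExpect_fixed_const_equiv_spinAt φ hadj β (fun x _ => by simp [affCpl, hφv]) 1 k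

/-- `⟨σ_{φk}⟩⁻_{φ(Λ)} = ⟨σ_k⟩⁻_Λ` for a graph automorphism `φ` preserving `v`.
[cite: FriedliVelenik2017, Prop. 3.29 (proof)] -/
theorem minusMag_map_equiv (φ : V ≃ V) (hadj : ∀ x y, (G.Adj (φ x) (φ y) ↔ G.Adj x y))
    (hφv : ∀ x, v (φ x) = v x) (Λ : Finset V) (k : V) (s : ℝ) :
    minusMag G β v (Λ.map φ.toEmbedding) (φ k) s = minusMag G β v Λ k s :=
  fieldExpect_fixed_const_equiv_spinAt φ hadj β (fun x _ => by simp [affCpl, hφv]) (-1) k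

omit [DecidableEq V] [G.LocallyFinite] in
/-- `Λ ↦ φ(Λ)` is onto the finite volumes. [folklore] -/
theorem surjective_map_equiv (φ : V ≃ V) :
    Function.Surjective fun Λ : Finset V => Λ.map φ.toEmbedding := fun Λ =>
  ⟨Λ.map φ.symm.toEmbedding, by
    simp only [Finset.map_map]
    convert Finset.map_refl (s := Λ)
    ext x
    simp⟩

/-- **Periodicity of `m⁺`**: `m⁺_{φk} = m⁺_k` for a graph automorphism `φ` preserving `v`.
[cite: FriedliVelenik2017, Prop. 3.29 (proof)] -/
theorem infPlusMag_equiv (φ : V ≃ V) (hadj : ∀ x y, (G.Adj (φ x) (φ y) ↔ G.Adj x y))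
    (hφv : ∀ x, v (φ x) = v x) (k : V) (s : ℝ) :
    infPlusMag G β v (φ k) s = infPlusMag G β v k s := by
  unfold infPlusMag
  rw [← (surjective_map_equiv φ).iInf_comp (fun Λ => plusMag G β v Λ (φ k) s)]
  simp only [plusMag_map_equiv φ hadj hφv]

/-- **Periodicity of `m⁻`**: `m⁻_{φk} = m⁻_k`. [cite: FriedliVelenik2017, Prop. 3.29 (proof)] -/
theorem supMinusMag_equiv (φ : V ≃ V) (hadj : ∀ x y, (G.Adj (φ x) (φ y) ↔ G.Adj x y))
    (hφv : ∀ x, v (φ x) = v x) (k : V) (s : ℝ) :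
    supMinusMag G β v (φ k) s = supMinusMag G β v k s := by
  unfold supMinusMag
  rw [← (surjective_map_equiv φ).iSup_comp (fun Λ => minusMag G β v Λ (φ k) s)]
  simp only [minusMag_map_equiv φ hadj hφv]

/-! ### The free-energy inequality in a finite volume -/

/-- The field-weighted sum of one-point functions is the expectation of `V = ∑ v_kσ_k`.
[cite: FriedliVelenik2017, Lemma 3.31 (1)] -/
theorem sum_mul_fieldExpect_spinAt (Λ : Finset V) (h : V → ℝ) (bc : BoundaryCondition V) :
    ∑ k ∈ Λ, v k * fieldExpect G Λ β h bc (spinAt k) = fieldExpect G Λ β h bc (raySpin Λ v) := by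
  unfold raySpin
  rw [fieldExpect_finset_sum G Λ β h bc Λ (fun k σ => v k * spinAt k σ)
    (fun k => (measurable_spinAt k).const_mul _)]
  exact Finset.sum_congr rfl fun k _ => (fieldExpect_const_mul G Λ β h bc _ (measurable_spinAt k)).symm

/-- **Mean-value bound from the convexity of the free energy**: for `s < s'` and any fixed
boundary condition, `β(s'-s)⟨V⟩_{Λ;sv} ≤ log Z_{Λ;s'v} - log Z_{Λ;sv} ≤ β(s'-s)⟨V⟩_{Λ;s'v}`
(the derivative `β⟨V⟩` of `log Z` along the ray is nondecreasing; Friedli–Velenik 2017,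
Lemma 3.5 and eq. (3.9)). [cite: FriedliVelenik2017, Lemma 3.5 and Theorem 3.34 (proof)] -/
theorem log_fieldZ_sub_mem_Icc (hβ : 0 ≤ β) (Λ : Finset V) (η : SpinConfig V) {s s' : ℝ}
    (hss' : s < s') :
    Real.log (fieldZ G Λ β (affCpl 0 v s') (.fixed η)) -
        Real.log (fieldZ G Λ β (affCpl 0 v s) (.fixed η)) ∈
      Set.Icc (β * (s' - s) * fieldExpect G Λ β (affCpl 0 v s) (.fixed η) (raySpin Λ v))
        (β * (s' - s) * fieldExpect G Λ β (affCpl 0 v s') (.fixed η) (raySpin Λ v)) := by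
  set F : ℝ → ℝ := fun t => Real.log (fieldZ G Λ β (affCpl 0 v t) (.fixed η)) with hF
  set D : ℝ → ℝ := fun t => β * fieldExpect G Λ β (affCpl 0 v t) (.fixed η) (raySpin Λ v) with hD
  have hderiv : ∀ t, HasDerivAt F (D t) t := fun t => hasDerivAt_log_fieldZ_ray G Λ β 0 v _ t
  obtain ⟨ξ, hξ, hslope⟩ := exists_hasDerivAt_eq_slope F D hss'
    (fun t _ => (hderiv t).continuousAt.continuousWithinAt) (fun t _ => hderiv t)
  have hmono := monotone_fieldExpect_raySpin_ray G hβ Λ (0 : V → ℝ) v (.fixed η)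
  have hpos : 0 < s' - s := sub_pos.2 hss'
  have hkey : F s' - F s = (s' - s) * D ξ := by
    rw [hslope]; field_simp
  change F s' - F s ∈ Set.Icc (β * (s' - s) * _) (β * (s' - s) * _)
  rw [hkey, hD]
  constructor
  · have := hmono (le_of_lt hξ.1)
    nlinarith [mul_le_mul_of_nonneg_left this hβ]
  · have := hmono (le_of_lt hξ.2)
    nlinarith [mul_le_mul_of_nonneg_left this hβ]

/-- **The basic finite-volume inequality**: for `β > 0` and `s < s'`,
`∑_{k∈Λ} v_k ⟨σ_k⟩⁺_Λ(s) - ∑_{k∈Λ} v_k ⟨σ_k⟩⁻_Λ(s') ≤ 4|∂ᵉΛ|/(s'-s)`: combine the mean-value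
bounds for the `+` and `-` boundary conditions with `|log Z⁺_Λ - log Z⁻_Λ| ≤ 2β|∂ᵉΛ|`
(`abs_log_fieldZ_fixed_sub_le`). This is the finite-volume form of
`∂ψ/∂h⁺(s) ≤ ∂ψ/∂h⁻(s')`, the pressure being independent of the boundary condition
(Friedli–Velenik 2017, Theorem 3.6 and Theorem 3.34).
[cite: FriedliVelenik2017, Theorem 3.34 (proof) and §3.2.1 (proof of Theorem 3.6)] -/
theorem sumPlusMag_sub_sumMinusMag_le (hβ : 0 < β) (Λ : Finset V) {s s' : ℝ} (hss' : s < s') :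
    ∑ k ∈ Λ, v k * plusMag G β v Λ k s - ∑ k ∈ Λ, v k * minusMag G β v Λ k s' ≤
      4 * (edgeBoundary G Λ).card / (s' - s) := by
  have hpos : 0 < s' - s := sub_pos.2 hss'
  simp only [plusMag, minusMag]
  rw [sum_mul_fieldExpect_spinAt (G := G) (β := β) (v := v),
    sum_mul_fieldExpect_spinAt (G := G) (β := β) (v := v)]
  set Sp := fieldExpect G Λ β (affCpl 0 v s) .plus (raySpin Λ v)
  set Sm := fieldExpect G Λ β (affCpl 0 v s') .minus (raySpin Λ v)
  have hplus := (log_fieldZ_sub_mem_Icc (G := G) (v := v) hβ.le Λ 1 hss').1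
  have hminus := (log_fieldZ_sub_mem_Icc (G := G) (v := v) hβ.le Λ (-1) hss').2
  have hb1 := abs_log_fieldZ_fixed_sub_le G hβ.le Λ (affCpl 0 v s') (-1) 1
  have hb2 := abs_log_fieldZ_fixed_sub_le G hβ.le Λ (affCpl 0 v s) (-1) 1
  rw [abs_le] at hb1 hb2
  change β * (s' - s) * Sp ≤ _ at hplus
  change _ ≤ β * (s' - s) * Sm at hminus
  -- `β(s'-s)(Sp - Sm) ≤ 4β|∂Λ|`
  have hkey : β * (s' - s) * (Sp - Sm) ≤ β * (4 * (edgeBoundary G Λ).card) := by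
    nlinarith [hb1.1, hb1.2, hb2.1, hb2.2]
  have h2 : (s' - s) * (Sp - Sm) ≤ 4 * (edgeBoundary G Λ).card := by
    have hkey' : β * ((s' - s) * (Sp - Sm)) ≤ β * (4 * (edgeBoundary G Λ).card) := by
      rw [← mul_assoc]; exact hkey
    exact le_of_mul_le_mul_left hkey' hβ
  rw [le_div_iff₀ hpos]
  linarith

/-! ### The main theorem: `m⁺ = m⁻` at the sites carrying the field -/

/-- Sums over a volume tiled by automorphic copies of a cell. [folklore] -/
theorem sum_tiled {ι : Type*} (φ : ι → V ≃ V) (cell : Finset V) (B : Finset ι)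
    (hdisj : (↑B : Set ι).PairwiseDisjoint fun i => cell.map (φ i).toEmbedding) (g : V → ℝ) :
    ∑ k ∈ B.biUnion (fun i => cell.map (φ i).toEmbedding), g k =
      ∑ i ∈ B, ∑ c ∈ cell, g (φ i c) := by
  rw [Finset.sum_biUnion hdisj]
  exact Finset.sum_congr rfl fun i _ => by rw [Finset.sum_map]; rfl

/-- **The cell sums compare across a field gap**: under the tiling/van Hove hypotheses, for
`β > 0`, `v ≥ 0` and `s < s'`, `∑_{c∈cell} v_c m⁺_c(s) ≤ ∑_{c∈cell} v_c m⁻_c(s')` (the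
finite-volume inequality `sumPlusMag_sub_sumMinusMag_le` for `Λₙ`, the bounds `⟨σ_k⟩⁺_{Λₙ} ≥ m⁺_k`,
`⟨σ_k⟩⁻_{Λₙ} ≤ m⁻_k`, periodicity of `m^±`, and `|∂ᵉΛₙ|/#Bₙ → 0`).
[cite: FriedliVelenik2017, Theorem 3.34 (proof)] -/
theorem cellSum_infPlusMag_le_cellSum_supMinusMag (hβ : 0 < β) (hv : ∀ x, 0 ≤ v x)
    {ι : Type*} (φ : ι → V ≃ V) (hφG : ∀ i x y, (G.Adj (φ i x) (φ i y) ↔ G.Adj x y))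
    (hφv : ∀ i x, v (φ i x) = v x) (cell : Finset V) (B : ℕ → Finset ι) (Λ : ℕ → Finset V)
    (hΛ : ∀ n, Λ n = (B n).biUnion fun i => cell.map (φ i).toEmbedding)
    (hdisj : ∀ n, (↑(B n) : Set ι).PairwiseDisjoint fun i => cell.map (φ i).toEmbedding)
    (hB : ∀ n, (B n).Nonempty)
    (hratio : Tendsto (fun n => ((edgeBoundary G (Λ n)).card : ℝ) / (B n).card) atTop (𝓝 0))
    {s s' : ℝ} (hss' : s < s') :
    ∑ c ∈ cell, v c * infPlusMag G β v c s ≤ ∑ c ∈ cell, v c * supMinusMag G β v c s' := by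
  have hpos : 0 < s' - s := sub_pos.2 hss'
  set Mp := ∑ c ∈ cell, v c * infPlusMag G β v c s
  set Mm := ∑ c ∈ cell, v c * supMinusMag G β v c s'
  -- for every `n`: `#B_n (Mp - Mm) ≤ 4|∂Λ_n|/(s'-s)`
  have hn : ∀ n, Mp - Mm ≤ (4 / (s' - s)) * (((edgeBoundary G (Λ n)).card : ℝ) / (B n).card) := by
    intro n
    have hcard : (0 : ℝ) < (B n).card := by exact_mod_cast (hB n).card_pos
    have hfin := sumPlusMag_sub_sumMinusMag_le (G := G) (v := v) hβ (Λ n) hss'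
    -- lower bound the `+` sum and upper bound the `-` sum by the tiled cell sums
    have hlow : ((B n).card : ℝ) * Mp ≤ ∑ k ∈ Λ n, v k * plusMag G β v (Λ n) k s := by
      calc ((B n).card : ℝ) * Mp = ∑ _i ∈ B n, Mp := by rw [Finset.sum_const, nsmul_eq_mul]
        _ = ∑ i ∈ B n, ∑ c ∈ cell, v (φ i c) * infPlusMag G β v (φ i c) s := by
            refine Finset.sum_congr rfl fun i _ => Finset.sum_congr rfl fun c _ => ?_
            rw [hφv, infPlusMag_equiv (φ i) (hφG i) (hφv i)]
        _ = ∑ k ∈ Λ n, v k * infPlusMag G β v k s := by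
            rw [hΛ n, sum_tiled φ cell (B n) (hdisj n)]
        _ ≤ ∑ k ∈ Λ n, v k * plusMag G β v (Λ n) k s := Finset.sum_le_sum fun k _ =>
            mul_le_mul_of_nonneg_left (infPlusMag_le_plusMag (Λ n) k s) (hv k)
    have hup : ∑ k ∈ Λ n, v k * minusMag G β v (Λ n) k s' ≤ ((B n).card : ℝ) * Mm := by
      calc ∑ k ∈ Λ n, v k * minusMag G β v (Λ n) k s'
          ≤ ∑ k ∈ Λ n, v k * supMinusMag G β v k s' := Finset.sum_le_sum fun k _ =>
            mul_le_mul_of_nonneg_left (minusMag_le_supMinusMag (Λ n) k s') (hv k)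
        _ = ∑ i ∈ B n, ∑ c ∈ cell, v (φ i c) * supMinusMag G β v (φ i c) s' := by
            rw [hΛ n, sum_tiled φ cell (B n) (hdisj n)]
        _ = ∑ _i ∈ B n, Mm := by
            refine Finset.sum_congr rfl fun i _ => Finset.sum_congr rfl fun c _ => ?_
            rw [hφv, supMinusMag_equiv (φ i) (hφG i) (hφv i)]
        _ = ((B n).card : ℝ) * Mm := by rw [Finset.sum_const, nsmul_eq_mul]
    have hmain : ((B n).card : ℝ) * (Mp - Mm) ≤ 4 * (edgeBoundary G (Λ n)).card / (s' - s) := by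
      nlinarith [hlow, hup, hfin]
    have hmain' : ((B n).card : ℝ) * (Mp - Mm) * (s' - s) ≤ 4 * (edgeBoundary G (Λ n)).card :=
      (le_div_iff₀ hpos).1 hmain
    rw [div_mul_div_comm, le_div_iff₀ (mul_pos hpos hcard)]
    have hre : (Mp - Mm) * ((s' - s) * ((B n).card : ℝ)) = ((B n).card : ℝ) * (Mp - Mm) * (s' - s) := by
      ring
    rw [hre]
    exact hmain' 
  -- let `n → ∞`
  have hlim : Tendsto (fun n => (4 / (s' - s)) * (((edgeBoundary G (Λ n)).card : ℝ) / (B n).card))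
      atTop (𝓝 0) := by
    simpa using hratio.const_mul (4 / (s' - s))
  have := ge_of_tendsto' hlim hn
  linarith

/-- **The chord bound from GHS concavity**: for `0 ≤ s ≤ s₀`, `0 < s₀`, `β ≥ 0`, `v ≥ 0` and any
finite `Λ`, `⟨σ_c⟩⁺_Λ(s) ≥ ((s₀-s)/s₀) ⟨σ_c⟩⁺_Λ(0) + (s/s₀) ⟨σ_c⟩⁺_Λ(s₀)` (for `c ∉ Λ` the
function is constant). [cite: FriedliVelenik2017, Remark 3.41 (p. 126)] -/
theorem plusMag_chord (hβ : 0 ≤ β) (hv : ∀ x, 0 ≤ v x) (Λ : Finset V) (c : V) {s s₀ : ℝ}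
    (hs : 0 ≤ s) (hss₀ : s ≤ s₀) (hs₀ : 0 < s₀) :
    (s₀ - s) / s₀ * plusMag G β v Λ c 0 + s / s₀ * plusMag G β v Λ c s₀ ≤ plusMag G β v Λ c s := by
  have ha : 0 ≤ (s₀ - s) / s₀ := div_nonneg (sub_nonneg.2 hss₀) hs₀.le
  have hb : 0 ≤ s / s₀ := div_nonneg hs hs₀.le
  have hab : (s₀ - s) / s₀ + s / s₀ = 1 := by field_simp; ring
  by_cases hc : c ∈ Λ
  · have hconc := concaveOn_fieldExpect_spinAt_ray G hβ (b := 0) (v := v) (fun _ _ => le_rfl)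
      (fun x _ => hv x) (Or.inr rfl) hc
    have key := hconc.2 (mem_Ici.2 (le_refl (0 : ℝ))) (mem_Ici.2 hs₀.le) ha hb hab
    have hpt : ((s₀ - s) / s₀) • (0 : ℝ) + (s / s₀) • s₀ = s := by
      rw [smul_eq_mul, smul_eq_mul, mul_zero, zero_add, div_mul_cancel₀ _ hs₀.ne']
    rw [hpt] at key
    simpa only [smul_eq_mul, plusMag] using key
  · -- `c ∉ Λ`: the spin is frozen to `+1`, all three values are `1`
    have hconst : ∀ t, plusMag G β v Λ c t = 1 := by
      intro t
      unfold plusMag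
      rw [fieldExpect_eq_sum_div G Λ β _ _ (measurable_spinAt c)]
      have hsp : ∀ τ : Λ → ℤˣ, spinAt c (glue Λ τ .plus) = 1 := fun τ => by
        simp only [spinAt, glue_apply_of_notMem _ _ _ hc, BoundaryCondition.plus,
          BoundaryCondition.outside_fixed, Pi.one_apply, Units.val_one, Int.cast_one]
      simp only [hsp, mul_one]
      exact div_self (fieldZ_pos G Λ β _ _).ne'
    rw [hconst, hconst, hconst]
    nlinarith [hab]

/-- **Absence of phase coexistence at the field-carrying sites of a periodic system (`m⁺ = m⁻`
there).** Let `G` be a locally finite graph and `v ≥ 0` a field profile, both invariant under a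
family of graph automorphisms `φᵢ`; let the finite `cell` tile the volumes
`Λₙ = ⋃_{i ∈ Bₙ} φᵢ(cell)` disjointly, with `|∂ᵉΛₙ| / #Bₙ → 0`. Then for `β > 0`, `s₀ > 0` and every
site `c` of the cell with `v_c > 0`: for every `ε > 0` there is a finite `Λ₀` such that
`⟨σ_c⟩⁺_{Λ;β,s₀v} - ⟨σ_c⟩⁻_{Λ;β,s₀v} ≤ ε` for all finite `Λ ⊇ Λ₀` — the `+` and `-` boundary
conditions induce the same magnetisation at `c` in the infinite-volume limit. Proof
(Friedli–Velenik 2017, Remark 3.41 with Theorem 3.34, in finite volume): the cell sums satisfy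
`M⁺(s) ≤ M⁻(s₀)` for `s < s₀` (`cellSum_infPlusMag_le_cellSum_supMinusMag`) and, by the GHS chord
bound, `M⁺(s) ≥ -((s₀-s)/s₀) ∑ v_c + (s/s₀) M⁺(s₀) → M⁺(s₀)` as `s ↑ s₀`; hence `M⁻(s₀) ≥ M⁺(s₀)`,
and since `m⁻_c ≤ m⁺_c` termwise, `v_c (m⁺_c(s₀) - m⁻_c(s₀)) = 0` for every `c`.
[cite: FriedliVelenik2017, Remark 3.41 and Theorem 3.34] -/
theorem exists_volume_plusMag_sub_minusMag_le (hβ : 0 < β) (hv : ∀ x, 0 ≤ v x) {s₀ : ℝ}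
    (hs₀ : 0 < s₀) {ι : Type*} (φ : ι → V ≃ V) (hφG : ∀ i x y, (G.Adj (φ i x) (φ i y) ↔ G.Adj x y))
    (hφv : ∀ i x, v (φ i x) = v x) (cell : Finset V) (B : ℕ → Finset ι) (Λ : ℕ → Finset V)
    (hΛ : ∀ n, Λ n = (B n).biUnion fun i => cell.map (φ i).toEmbedding)
    (hdisj : ∀ n, (↑(B n) : Set ι).PairwiseDisjoint fun i => cell.map (φ i).toEmbedding)
    (hB : ∀ n, (B n).Nonempty)
    (hratio : Tendsto (fun n => ((edgeBoundary G (Λ n)).card : ℝ) / (B n).card) atTop (𝓝 0))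
    {c : V} (hc : c ∈ cell) (hvc : 0 < v c) {ε : ℝ} (hε : 0 < ε) :
    ∃ Λ₀ : Finset V, ∀ Λ' : Finset V, Λ₀ ⊆ Λ' →
      plusMag G β v Λ' c s₀ - minusMag G β v Λ' c s₀ ≤ ε := by
  set Mp : ℝ → ℝ := fun t => ∑ c ∈ cell, v c * infPlusMag G β v c t with hMp
  set Mm : ℝ → ℝ := fun t => ∑ c ∈ cell, v c * supMinusMag G β v c t with hMm
  set Sv : ℝ := ∑ c ∈ cell, v c with hSv
  -- Step 1: `M⁺(s) ≤ M⁻(s₀)` for `s < s₀`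
  have step1 : ∀ s, s < s₀ → Mp s ≤ Mm s₀ := fun s hs =>
    cellSum_infPlusMag_le_cellSum_supMinusMag hβ hv φ hφG hφv cell B Λ hΛ hdisj hB hratio hs
  -- Step 2: chord bound `M⁺(s) ≥ -((s₀-s)/s₀) Sv + (s/s₀) M⁺(s₀)` for `0 ≤ s ≤ s₀`
  have step2 : ∀ s, 0 ≤ s → s ≤ s₀ → -((s₀ - s) / s₀) * Sv + s / s₀ * Mp s₀ ≤ Mp s := by
    intro s hs hss₀
    have ha : 0 ≤ (s₀ - s) / s₀ := div_nonneg (sub_nonneg.2 hss₀) hs₀.le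
    have hb : 0 ≤ s / s₀ := div_nonneg hs hs₀.le
    have hterm : ∀ c', -((s₀ - s) / s₀) + s / s₀ * infPlusMag G β v c' s₀ ≤ infPlusMag G β v c' s := by
      intro c'
      refine le_ciInf fun Λ' => ?_
      have hch : (s₀ - s) / s₀ * plusMag G β v Λ' c' 0 + s / s₀ * plusMag G β v Λ' c' s₀ ≤
          plusMag G β v Λ' c' s := plusMag_chord (G := G) (v := v) hβ.le hv Λ' c' hs hss₀ hs₀
      have h0 : (-1 : ℝ) ≤ plusMag G β v Λ' c' 0 := (abs_le.1 (abs_plusMag_le_one Λ' c' 0)).1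
      have h1 : infPlusMag G β v c' s₀ ≤ plusMag G β v Λ' c' s₀ := infPlusMag_le_plusMag Λ' c' s₀
      have h0' : (s₀ - s) / s₀ * (-1 : ℝ) ≤ (s₀ - s) / s₀ * plusMag G β v Λ' c' 0 :=
        mul_le_mul_of_nonneg_left h0 ha
      have h1' : s / s₀ * infPlusMag G β v c' s₀ ≤ s / s₀ * plusMag G β v Λ' c' s₀ :=
        mul_le_mul_of_nonneg_left h1 hb
      linarith
    calc -((s₀ - s) / s₀) * Sv + s / s₀ * Mp s₀
        = ∑ c' ∈ cell, v c' * (-((s₀ - s) / s₀) + s / s₀ * infPlusMag G β v c' s₀) := by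
          simp only [hSv, hMp, Finset.mul_sum, ← Finset.sum_add_distrib]
          exact Finset.sum_congr rfl fun c' _ => by ring
      _ ≤ Mp s := Finset.sum_le_sum fun c' _ => mul_le_mul_of_nonneg_left (hterm c') (hv c')
  -- Step 3: `M⁻(s₀) ≥ M⁺(s₀)` by letting `s ↑ s₀` along `sₙ = s₀ - s₀/(n+2)`
  have step3 : Mp s₀ ≤ Mm s₀ := by
    set sq : ℕ → ℝ := fun n => s₀ - s₀ / ((n : ℝ) + 2) with hsq
    have hsq_lt : ∀ n, sq n < s₀ := fun n => by
      have : 0 < s₀ / ((n : ℝ) + 2) := by positivity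
      simp only [hsq]; linarith
    have hsq_nn : ∀ n, 0 ≤ sq n := fun n => by
      simp only [hsq]
      have h2 : (2 : ℝ) ≤ (n : ℝ) + 2 := by linarith [(n.cast_nonneg : (0 : ℝ) ≤ n)]
      have : s₀ / ((n : ℝ) + 2) ≤ s₀ / 2 := div_le_div_of_nonneg_left hs₀.le (by norm_num) h2
      linarith
    have hbound : ∀ n, -((s₀ - sq n) / s₀) * Sv + sq n / s₀ * Mp s₀ ≤ Mm s₀ := fun n =>
      (step2 (sq n) (hsq_nn n) (hsq_lt n).le).trans (step1 (sq n) (hsq_lt n))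
    -- the left-hand side tends to `Mp s₀`
    have hsq_tend : Tendsto sq atTop (𝓝 s₀) := by
      have h1 : Tendsto (fun n : ℕ => s₀ / ((n : ℝ) + 2)) atTop (𝓝 0) := by
        have : Tendsto (fun n : ℕ => ((n : ℝ) + 2)) atTop atTop :=
          tendsto_atTop_add_const_right _ _ tendsto_natCast_atTop_atTop
        exact tendsto_const_nhds.div_atTop this
      simpa [hsq] using tendsto_const_nhds.sub h1
    have hlhs : Tendsto (fun n => -((s₀ - sq n) / s₀) * Sv + sq n / s₀ * Mp s₀) atTop
        (𝓝 (-((s₀ - s₀) / s₀) * Sv + s₀ / s₀ * Mp s₀)) :=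
      ((((tendsto_const_nhds.sub hsq_tend).div_const s₀).neg.mul tendsto_const_nhds).add
        ((hsq_tend.div_const s₀).mul tendsto_const_nhds))
    have hval : -((s₀ - s₀) / s₀) * Sv + s₀ / s₀ * Mp s₀ = Mp s₀ := by
      rw [sub_self, zero_div, neg_zero, zero_mul, zero_add, div_self hs₀.ne', one_mul]
    rw [hval] at hlhs
    exact le_of_tendsto' hlhs hbound
  -- Step 4: termwise equality at `c`
  have step4 : infPlusMag G β v c s₀ = supMinusMag G β v c s₀ := by
    have hnn : ∀ c' ∈ cell, 0 ≤ v c' * (infPlusMag G β v c' s₀ - supMinusMag G β v c' s₀) :=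
      fun c' _ => mul_nonneg (hv c') (sub_nonneg.2 (supMinusMag_le_infPlusMag hβ.le c' s₀))
    have hsum : ∑ c' ∈ cell, v c' * (infPlusMag G β v c' s₀ - supMinusMag G β v c' s₀) = 0 := by
      refine le_antisymm ?_ (Finset.sum_nonneg hnn)
      have : ∑ c' ∈ cell, v c' * (infPlusMag G β v c' s₀ - supMinusMag G β v c' s₀) =
          Mp s₀ - Mm s₀ := by
        simp only [hMp, hMm, ← Finset.sum_sub_distrib]
        exact Finset.sum_congr rfl fun c' _ => by ring
      rw [this]; linarith
    have := (Finset.sum_eq_zero_iff_of_nonneg hnn).1 hsum c hc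
    rcases mul_eq_zero.1 this with h | h
    · exact absurd h hvc.ne'
    · linarith [supMinusMag_le_infPlusMag (G := G) (v := v) hβ.le c s₀]
  -- Step 5: finite volumes approximating the infimum and the supremum
  obtain ⟨Λ₁, hΛ₁⟩ : ∃ Λ₁ : Finset V, plusMag G β v Λ₁ c s₀ < infPlusMag G β v c s₀ + ε / 2 :=
    exists_lt_of_ciInf_lt (f := fun Λ₁ : Finset V => plusMag G β v Λ₁ c s₀)
      (show infPlusMag G β v c s₀ < infPlusMag G β v c s₀ + ε / 2 by linarith)
  obtain ⟨Λ₂, hΛ₂⟩ : ∃ Λ₂ : Finset V, supMinusMag G β v c s₀ - ε / 2 < minusMag G β v Λ₂ c s₀ :=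
    exists_lt_of_lt_ciSup (f := fun Λ₂ : Finset V => minusMag G β v Λ₂ c s₀)
      (show supMinusMag G β v c s₀ - ε / 2 < supMinusMag G β v c s₀ by linarith)
  refine ⟨Λ₁ ∪ Λ₂, fun Λ' hΛ' => ?_⟩
  have h1 : plusMag G β v Λ' c s₀ ≤ plusMag G β v Λ₁ c s₀ :=
    plusMag_anti hβ.le (Finset.union_subset_left hΛ') c s₀
  have h2 : minusMag G β v Λ₂ c s₀ ≤ minusMag G β v Λ' c s₀ :=
    minusMag_mono hβ.le (Finset.union_subset_right hΛ') c s₀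
  linarith

end Literature.Probability.LatticeModels

end
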